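import Summits.AtomisticToContinuum.HydrodynamicLimit.Theses.OneSphereInfluence
import Summits.AtomisticToContinuum.HydrodynamicLimit.Theses.ImplosionDichotomy

/-!
# Birth skeleton — crux `OneSphereInfluence.PreShockHomotopy` (stmt-AtomisticToContinuum-13621)

Registered skeleton (`Lines/birth.lean`, skeleton-register mode, route re-audit bin REPAIRABLE) for the
rank-9 crux `PreShockHomotopy` of route `OneSphereInfluence` (PRE-SHOCK HOMOTOPY WITH LOCAL-GIBBS MATCHING:
for the target profile `(a₁,u₁,θ₁)` there are `Λ ≥ 1`, `σ₀ > 0` such that for `σ < σ₀`, every classical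
hs-Euler solution on `[0,T)` tied to the local-Gibbs data, all flows and every `t < T`, there is `T' > t`, a
smooth profile path `κ ↦ (a_κ, u₀κ, θ₀κ)` from constants to the target inside the `Λ`-hull, and a jointly
`C^∞` family of classical solutions on `[0,T')` whose data are the LLN fields of the `κ`-profiles, `κ = 1`
member the given solution, `κ = 0` member constant, all laws probability measures).

THE CUT is the one foreseen in the route header (TWO-LAYER PLAN: `PreShockHomotopy ⇐ DataSpaceHomotopy
(pure PDE) → ActivityDensityInverse (statics)`), typed against what the tree now HAS
(`localGibbs_lln_holds`, `hsEuler_localExistence_holds`, `hsEuler_continuation_holds`,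
`Theorems.hsEosLowDensity_proof`, `IsHardSphereEulerSolution.restrict`, `isProbabilityMeasure_localGibbsLaw`):

* `stub_statics` — ACTIVITY↔DENSITY INVERSE ALONG PATHS (= `ActivityDensityInverse`; equilibrium statistical
  mechanics of the canonical hard-core local Gibbs law at small packing; size L, provable in kind from the
  tree's cluster-expansion LLN). For the target profile: `Λ`, `σ₀`; for `σ < σ₀` and any classical solution
  with LLN-matching data at `t = 0` (`T > 0`): (i) IDENTIFICATION by uniqueness of limits in probability under
  probability laws, `u(0) = u₁`, `θ(0) = θ₁` (and `ρ(0) =` the LLN density of `a₁`, used internally);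
  (ii) a jointly smooth ACTIVITY PATH `a` on `[0,1]` from a constant to `a₁` inside the `Λ`-hull of `a₁`
  together with its jointly smooth LLN-DENSITY PATH `r₀` from a constant to `ρ(0)`, positive and dominated
  pointwise by `max ρ(0)` (so the whole path is as dilute as the data) — this is where REGULARITY TRANSFER
  lives: `ρ(0)` smooth forces `a₁ = (chart)⁻¹(ρ(0))` smooth, the chart being the Nemytskii map of the
  analytic series `rhoLim` of `HardSphereEulerLLN`; (iii) LLN + probability along the path for ARBITRARY
  continuous velocity / positive temperature profiles `(w, ϑ)` (the configurational marginal does not see the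
  Maxwellian parameters; `localGibbs_densityLLN` has an `a₀`-only threshold; `isProbabilityMeasure_localGibbsLaw`
  for `σ ≤ 1/2`). [sources: Spohn1991 §2.3, LebowitzPenrose1964, Ruelle1969 §3.4–Ch.4]
* `stub_families` — PRE-SHOCK FAMILIES FOR THE HS-EULER SYSTEM (= `PreShockFamilies`; pure hyperbolic PDE, size
  XL; Kato1975 Thms I–III, Majda1984 Thm 2.1–2.2, Dafermos2005 Thm 5.1.1/5.2.1, Sideris1985 for why the path must
  dodge). In the Literature's equation-of-state convention (`hsExcessFreeEnergy = F` on `[0,η₀)`, `F`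
  analytic; cf. `hsEuler_localExistence`): `∃ η₁ > 0` such that for every `σ > 0`, every classical solution
  `(ρ,u,θ)` on `[0,T)`, every jointly smooth positive DENSITY-DATA PATH `r₀` on `[0,1]` (constant at `κ = 0`,
  `r₀ 1 = ρ 0`, dominated by `max ρ(0)`) and every `t < T` with packing `ρσ³ ≤ η₁` on `[0,t] × 𝕋³`: there are
  `T' > t`, a smooth REPARAMETRISATION `β : [0,1] → [0,1]` (`β 0 = 0`, `β 1 = 1`), jointly smooth temperature /
  velocity data paths `(ϑ₀, w₀)` (constant at `0`, `= (θ 0, u 0)` at `1`, `ϑ₀ > 0`) and a family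
  `(ρh, uh, θh)_κ` of classical solutions on `[0,T')`, jointly `C^∞` in `(κ,s,x)`, with data
  `(r₀ (β κ), w₀ κ, ϑ₀ κ)`, `κ = 1` member `(ρ,u,θ)` itself and `κ = 0` member constant. The freedom `β`,
  `(ϑ₀,w₀)` is the COOL-AND-SLOW DODGE of earlier shocks: `(ρ, λu, λ²θ)(λs)` solves the same system (exact for
  `p = ρθZ(ρσ³)`) and lives `1/λ` times longer, so leg 1 deforms the density at small `λ` (l.s.c. life span
  on a compact data family, then slow down), leg 2 runs `λ ↑ 1` at frozen density; smooth dependence on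
  data/parameters + classical uniqueness (`hsEuler_uniqueness_smallPacking`) glue the legs; `T' ≤ T`
  (`IsHardSphereEulerSolution.restrict`).
* `stub_dilute` — GUARD REMOVAL BY NAME: the shared statement item stmt-AtomisticToContinuum-3091
  (`ImplosionDichotomy.DiluteSelfConsistency`; open, suspect-false by implosion). Needed ONLY because the
  crux is filed UNGUARDED (`∀ σ < σ₀ ∀ classical solutions`, no packing bound — the D-0032 loophole; this
  crux is in the REPAIRABLE bin): it supplies `ρσ³ < η₁` on `[0,T)`. If the crux is repaired with the
  Statement's guard `∀ t ∈ Ico 0 T, ∀ x, ρ t x * σ^3 < η₀`, drop this stub and feed the guard to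
  `stub_families` directly (choose the route's `η₀ ≤ η₁`).
* by-name CLOSED input `ImplosionDichotomy.HsEosLowDensity` (stmt-0768, PROVED:
  `Theorems.hsEosLowDensity_proof`) discharges the equation-of-state hypothesis of `stub_families`; it is a
  hypothesis of `PreShockHomotopy_of` only to keep this file's imports light (not a stub, no `sorry`).

`PreShockHomotopy_of : stub_statics → stub_families → DiluteSelfConsistency → HsEosLowDensity →
OneSphereInfluence.PreShockHomotopy` is PROVED below (no `sorry`; ~45 lines of genuine glue, not a one-line
seam): EoS data from `HsEosLowDensity` ⇒ `η₁` from `stub_families`; `Λ, σS` from `stub_statics`, `σD` from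
`stub_dilute` at `η := η₁`; `σ₀ := min σS σD`; for `σ < σ₀`, a tied solution, flows and `t < T`: statics give
the identification, the activity path `a`, the density path `r₀` and LLN/probability along it; the guard on
`[0,t] ⊂ [0,T)` comes from `stub_dilute`; `stub_families` returns `T'`, `β`, `(ϑ₀,w₀)` and the solution
family; the crux's path is `(a ∘ β, ϑ₀, w₀)` (smooth by `isSmoothSpaceTimeOn_reparam`, in the hull because
`β` maps `[0,1]` into itself, endpoints by `β 0 = 0`, `β 1 = 1` and the identification), and the LLN clause
for the `κ`-member is the static LLN at activity `a (β κ)` with `(w,ϑ) := (w₀ κ, ϑ₀ κ)` (continuous as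
slices of smooth space-time fields) transported to the member's data by the congruence
`tendstoHydroFieldsAt_congr` (`TendstoHydroFieldsAt … 0` only reads the time-`0` slices).

DISPROOF USED: none exists yet (`ledger crux ls stmt-AtomisticToContinuum-13621`: no workfiles, no
`Disproof.lean`, 2026-08-17). NEGATIVES (`ledger negatives --problem AtomisticToContinuum`, 20 entries, read
2026-08-17): no stub restates one — in particular stmt-9168 (`AdjointEnskogTestFamily`, refuted by the constant
state at packing `1000` on the junk branch of the equation of state) is exactly why `stub_families` is GUARDED
(`ρσ³ ≤ η₁`, `η₁` chosen after the analytic EoS data) and why the unguarded remainder is isolated in the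
by-name item 3091 rather than hidden in the PDE statement; nothing here is cell-wise at finite `N`
(≠ 9236/9238/6610/6612) and no exponential velocity moment is claimed (≠ 14607).
-/

noncomputable section

namespace Summit.AtomisticToContinuum.HydrodynamicLimit.Cruxes.PreShockHomotopy.Birth

open scoped Topology ENNReal
open Filter Set MeasureTheory
open Literature.MathematicalPhysics.KineticTheory
open Literature.Analysis.FluidPDE
open Summit.AtomisticToContinuum.HydrodynamicLimit.Theses

/-! ## The two new statements of the line, as named `Prop`s (the registered stubs below spell them out
verbatim; `*_holds` checks the spellings agree) -/

/-- ACTIVITY↔DENSITY INVERSE ALONG PATHS (statics half of the crux). For continuous positive target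
profiles `(a₁, θ₁, u₁)` there are `Λ ≥ 1` and `σ₀ > 0` such that for `0 < σ < σ₀`, every classical
hs-Euler solution `(ρ,u,θ)` on `[0,T)`, `T > 0`, and all flows `Φ` with
`TendstoHydroFieldsAt (localGibbsLaw σ a₁ u₁ θ₁) Φ ρ u θ 0`: (i) `u 0 = u₁`, `θ 0 = θ₁`; (ii) there are
jointly smooth paths `a` (activity) and `r₀` (density) on `[0,1] × 𝕋³` with `a` in the `Λ`-hull of `a₁`,
`r₀ > 0` and `r₀ κ x ≤ ρ 0 y` for some `y`, both constant in `x` at `κ = 0`, `a 1 = a₁`, `r₀ 1 = ρ 0`;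
(iii) for every `κ ∈ [0,1]` and all continuous `w`, `ϑ > 0` the laws `localGibbsLaw σ (a κ) w ϑ N (Φ N)`
are probability measures and their empirical fields at time `0` converge in probability to
`(r₀ κ, r₀ κ · w, r₀ κ (|w|²/2 + 3ϑ/2))`. -/
def ActivityDensityInverse : Prop :=
  ∀ (a₁ θ₁ : T3 → ℝ) (u₁ : T3 → V3), Continuous a₁ → Continuous θ₁ → Continuous u₁ →
    (∀ x, 0 < a₁ x) → (∀ x, 0 < θ₁ x) →
    ∃ Λ : ℝ, 1 ≤ Λ ∧ ∃ σ₀ : ℝ, 0 < σ₀ ∧ ∀ σ : ℝ, 0 < σ → σ < σ₀ →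
      ∀ (T : ℝ) (ρ θ : ℝ → T3 → ℝ) (u : ℝ → T3 → V3), IsHardSphereEulerSolution σ T ρ u θ →
        ∀ Φ : (N : ℕ) → HardSphereFlow (Torus.geometry (Fin 3)) (hsDiameter σ N) (N + 1),
          TendstoHydroFieldsAt (fun N => localGibbsLaw σ a₁ u₁ θ₁ N (Φ N)) Φ ρ u θ 0 → 0 < T →
            u 0 = u₁ ∧ θ 0 = θ₁ ∧
            ∃ (a r₀ : ℝ → T3 → ℝ),
              Literature.Analysis.FunctionSpaces.Torus.IsSmoothSpaceTimeOn (Set.Icc 0 1) a ∧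
              Literature.Analysis.FunctionSpaces.Torus.IsSmoothSpaceTimeOn (Set.Icc 0 1) r₀ ∧
              (∀ κ ∈ Set.Icc (0 : ℝ) 1, ∀ x, Λ⁻¹ * (⨅ y, a₁ y) ≤ a κ x ∧ a κ x ≤ Λ * (⨆ y, a₁ y)) ∧
              (∀ κ ∈ Set.Icc (0 : ℝ) 1, ∀ x, 0 < r₀ κ x ∧ ∃ y, r₀ κ x ≤ ρ 0 y) ∧
              (∀ x, a 0 x = a 0 0 ∧ r₀ 0 x = r₀ 0 0) ∧ a 1 = a₁ ∧ r₀ 1 = ρ 0 ∧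
              ∀ κ ∈ Set.Icc (0 : ℝ) 1, ∀ (w : T3 → V3) (ϑ : T3 → ℝ), Continuous w → Continuous ϑ →
                (∀ x, 0 < ϑ x) →
                (∀ N, IsProbabilityMeasure (localGibbsLaw σ (a κ) w ϑ N (Φ N))) ∧
                TendstoHydroFieldsAt (fun N => localGibbsLaw σ (a κ) w ϑ N (Φ N)) Φ
                  (fun _ => r₀ κ) (fun _ => w) (fun _ => ϑ) 0

/-- PRE-SHOCK FAMILIES FOR THE HARD-SPHERE EULER SYSTEM (PDE half of the crux), in the equation-of-state
convention of `hsEuler_localExistence`: IF `hsExcessFreeEnergy = F` on `[0, η₀)` with `F` analytic on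
`(-η₀, η₀)`, THEN there is `η₁ > 0` such that for every `σ > 0`, every classical solution `(ρ,u,θ)` on
`[0,T)`, every jointly smooth density-data path `r₀` on `[0,1]` (positive, dominated by `ρ 0`, constant at
`κ = 0`, `r₀ 1 = ρ 0`) and every `t ∈ [0,T)` with `ρ s x σ³ ≤ η₁` on `[0,t] × 𝕋³`, there are `T' > t`, a
smooth reparametrisation `β` of `[0,1]` fixing the endpoints, jointly smooth temperature / velocity data paths
`ϑ₀ > 0`, `w₀` (constant at `0`, equal to `θ 0`, `u 0` at `1`) and a family `(ρh κ, uh κ, θh κ)` of classical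
solutions on `[0,T')`, jointly `C^∞` on `[0,1] × [0,T') × 𝕋³`, with data `(r₀ (β κ), w₀ κ, ϑ₀ κ)`, `κ = 1`
member `(ρ,u,θ)` and `κ = 0` member constant on `[0,T')`. -/
def PreShockFamilies : Prop :=
  ∀ η₀ : ℝ, 0 < η₀ → ∀ F : ℝ → ℝ, AnalyticOnNhd ℝ F (Set.Ioo (-η₀) η₀) →
    Set.EqOn hsExcessFreeEnergy F (Set.Ico 0 η₀) →
    ∃ η₁ : ℝ, 0 < η₁ ∧ ∀ σ : ℝ, 0 < σ →
      ∀ (T : ℝ) (ρ θ : ℝ → T3 → ℝ) (u : ℝ → T3 → V3), IsHardSphereEulerSolution σ T ρ u θ →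
      ∀ r₀ : ℝ → T3 → ℝ, Literature.Analysis.FunctionSpaces.Torus.IsSmoothSpaceTimeOn (Set.Icc 0 1) r₀ →
        (∀ κ ∈ Set.Icc (0 : ℝ) 1, ∀ x, 0 < r₀ κ x ∧ ∃ y, r₀ κ x ≤ ρ 0 y) →
        (∀ x, r₀ 0 x = r₀ 0 0) → r₀ 1 = ρ 0 →
        ∀ t ∈ Set.Ico 0 T, (∀ s ∈ Set.Icc 0 t, ∀ x, ρ s x * σ ^ 3 ≤ η₁) →
          ∃ T' : ℝ, t < T' ∧
          ∃ (β : ℝ → ℝ) (ϑ₀ : ℝ → T3 → ℝ) (w₀ : ℝ → T3 → V3)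
            (ρh θh : ℝ → ℝ → T3 → ℝ) (uh : ℝ → ℝ → T3 → V3),
            ContDiffOn ℝ ((⊤ : ℕ∞) : WithTop ℕ∞) β (Set.Icc 0 1) ∧
            (∀ κ ∈ Set.Icc (0 : ℝ) 1, β κ ∈ Set.Icc (0 : ℝ) 1) ∧ β 0 = 0 ∧ β 1 = 1 ∧
            Literature.Analysis.FunctionSpaces.Torus.IsSmoothSpaceTimeOn (Set.Icc 0 1) ϑ₀ ∧
            Literature.Analysis.FunctionSpaces.Torus.IsSmoothSpaceTimeOn (Set.Icc 0 1) w₀ ∧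
            (∀ κ ∈ Set.Icc (0 : ℝ) 1, ∀ x, 0 < ϑ₀ κ x) ∧
            (∀ x, ϑ₀ 0 x = ϑ₀ 0 0 ∧ w₀ 0 x = w₀ 0 0) ∧ ϑ₀ 1 = θ 0 ∧ w₀ 1 = u 0 ∧
            (∀ κ ∈ Set.Icc (0 : ℝ) 1, IsHardSphereEulerSolution σ T' (ρh κ) (uh κ) (θh κ)) ∧
            ContDiffOn ℝ ((⊤ : ℕ∞) : WithTop ℕ∞)
              (fun q : ℝ × ℝ × EuclideanSpace ℝ (Fin 3) =>
                ρh q.1 q.2.1 (Literature.Analysis.FunctionSpaces.Torus.proj q.2.2))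
              (Set.Icc 0 1 ×ˢ (Set.Ico 0 T' ×ˢ Set.univ)) ∧
            ContDiffOn ℝ ((⊤ : ℕ∞) : WithTop ℕ∞)
              (fun q : ℝ × ℝ × EuclideanSpace ℝ (Fin 3) =>
                uh q.1 q.2.1 (Literature.Analysis.FunctionSpaces.Torus.proj q.2.2))
              (Set.Icc 0 1 ×ˢ (Set.Ico 0 T' ×ˢ Set.univ)) ∧
            ContDiffOn ℝ ((⊤ : ℕ∞) : WithTop ℕ∞)
              (fun q : ℝ × ℝ × EuclideanSpace ℝ (Fin 3) =>
                θh q.1 q.2.1 (Literature.Analysis.FunctionSpaces.Torus.proj q.2.2))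
              (Set.Icc 0 1 ×ˢ (Set.Ico 0 T' ×ˢ Set.univ)) ∧
            (∀ κ ∈ Set.Icc (0 : ℝ) 1, ρh κ 0 = r₀ (β κ) ∧ uh κ 0 = w₀ κ ∧ θh κ 0 = ϑ₀ κ) ∧
            ρh 1 = ρ ∧ uh 1 = u ∧ θh 1 = θ ∧
            (∀ s ∈ Set.Ico 0 T', ∀ x,
              ρh 0 s x = ρh 0 0 0 ∧ uh 0 s x = uh 0 0 0 ∧ θh 0 s x = θh 0 0 0)

/-! ## Registered stubs (the only `sorry`s of this file) -/

/-- `stub_statics` — ACTIVITY↔DENSITY INVERSE ALONG PATHS (= `ActivityDensityInverse` verbatim; size L;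
provable in kind). Proof route: `σ₀ ≤ 1/2` and below the `a₀`-only LLN threshold of `localGibbs_densityLLN`
made uniform over profiles with values in `[inf a₁, sup a₁]` (`exists_smallDensity`, `HardSphereEulerLLN`);
(i) both `(ρ,u,θ)(0)` (hypothesis) and `(rhoLim, u₁, θ₁)` (`localGibbs_lln_holds`) are limits in probability
of the same empirical fields under PROBABILITY laws (`isProbabilityMeasure_localGibbsLaw`, `σ ≤ 1/2`), so
`∫χρ(0) = ∫χ rhoLim` for all continuous `χ`, hence `ρ 0 = rhoLim` (continuity; `eq_zero_of_integral_eq_zero…`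
style), then `u 0 = u₁` (`ρ 0 > 0`) and `θ 0 = θ₁` from the momentum / energy fields; (ii) density path
`r₀ κ := (1-κ)·1 + κ·ρ 0` (unit mass: `empiricalDensityField_one` ⇒ `∫ρ 0 = 1` ⇒ `max ρ 0 ≥ 1`, so
`r₀ κ x ≤ max ρ 0`), activity path `a κ :=` the inverse of the analytic, strictly increasing one-point chart
`b ↦ Σ_j clusterCoeff σ j · r^{j+1} b^{j+1}` (`rhoLim`) applied to `r₀ κ`, rescaled into the `Λ`-hull
(activities are defined up to a constant factor in the canonical ensemble: `canonicalDensity` normalises) —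
jointly smooth because `ρ 0` is (`IsHardSphereEulerSolution.smooth_density`, `0 ∈ Ico 0 T`) and the chart is
analytic with positive derivative at small packing (this is the REGULARITY TRANSFER `a₁` smooth); (iii) the
configurational marginal of `localGibbsLaw σ a w ϑ` does not depend on `(w, ϑ)` (`∫ localMaxwellian = 1`,
`ϑ > 0`), velocities are conditionally independent local Maxwellians (`localGibbs_lln_of_densityLLN`).
[Spohn1991 §2.3; LebowitzPenrose1964; Ruelle1969 §3.4] -/
theorem stub_statics :
    ∀ (a₁ θ₁ : T3 → ℝ) (u₁ : T3 → V3), Continuous a₁ → Continuous θ₁ → Continuous u₁ →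
    (∀ x, 0 < a₁ x) → (∀ x, 0 < θ₁ x) →
    ∃ Λ : ℝ, 1 ≤ Λ ∧ ∃ σ₀ : ℝ, 0 < σ₀ ∧ ∀ σ : ℝ, 0 < σ → σ < σ₀ →
      ∀ (T : ℝ) (ρ θ : ℝ → T3 → ℝ) (u : ℝ → T3 → V3), IsHardSphereEulerSolution σ T ρ u θ →
        ∀ Φ : (N : ℕ) → HardSphereFlow (Torus.geometry (Fin 3)) (hsDiameter σ N) (N + 1),
          TendstoHydroFieldsAt (fun N => localGibbsLaw σ a₁ u₁ θ₁ N (Φ N)) Φ ρ u θ 0 → 0 < T →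
            u 0 = u₁ ∧ θ 0 = θ₁ ∧
            ∃ (a r₀ : ℝ → T3 → ℝ),
              Literature.Analysis.FunctionSpaces.Torus.IsSmoothSpaceTimeOn (Set.Icc 0 1) a ∧
              Literature.Analysis.FunctionSpaces.Torus.IsSmoothSpaceTimeOn (Set.Icc 0 1) r₀ ∧
              (∀ κ ∈ Set.Icc (0 : ℝ) 1, ∀ x, Λ⁻¹ * (⨅ y, a₁ y) ≤ a κ x ∧ a κ x ≤ Λ * (⨆ y, a₁ y)) ∧
              (∀ κ ∈ Set.Icc (0 : ℝ) 1, ∀ x, 0 < r₀ κ x ∧ ∃ y, r₀ κ x ≤ ρ 0 y) ∧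
              (∀ x, a 0 x = a 0 0 ∧ r₀ 0 x = r₀ 0 0) ∧ a 1 = a₁ ∧ r₀ 1 = ρ 0 ∧
              ∀ κ ∈ Set.Icc (0 : ℝ) 1, ∀ (w : T3 → V3) (ϑ : T3 → ℝ), Continuous w → Continuous ϑ →
                (∀ x, 0 < ϑ x) →
                (∀ N, IsProbabilityMeasure (localGibbsLaw σ (a κ) w ϑ N (Φ N))) ∧
                TendstoHydroFieldsAt (fun N => localGibbsLaw σ (a κ) w ϑ N (Φ N)) Φ
                  (fun _ => r₀ κ) (fun _ => w) (fun _ => ϑ) 0 := by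
  sorry

/-- `stub_families` — PRE-SHOCK FAMILIES FOR THE HS-EULER SYSTEM (= `PreShockFamilies` verbatim; size XL;
provable in kind: Kato1975 Thms I–III / Majda1984 Thm 2.1–2.2 / Dafermos2005 Thm 5.1.1, 5.2.1 with SMOOTH
dependence on data and parameters). Proof route (COOL-AND-SLOW DODGE): `η₁ :=` half the local-theory
threshold (`hsEuler_localExistence_holds`, `hsEuler_continuation_holds`, same `(η₀,F)`); the scaling
`(ρ, λu, λ²θ)(λs)` maps classical solutions to classical solutions (`p = ρθZ(ρσ³)`, `E` scale by `λ²`) and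
multiplies the life span by `1/λ`. LEG 1 (`κ ≤ 1/2`, `β` = `Real.smoothTransition (2κ)`): the compact,
`λ`-independent data family `(r₀ (β κ), β κ · u 0, (1-β κ)·θ̄ + β κ · θ 0)` has life spans bounded below
(l.s.c. of the life span = continuation principle + continuous dependence), so after slowing by a small `λ`
every member lives past `T' := min T (t+1)`; the slowed data are `(r₀ (β κ), λ β κ · u 0, λ²(…))`, i.e.
`w₀ κ`, `ϑ₀ κ` with `ϑ₀ > 0`, constant at `κ = 0` (constant data ⇒ constant solution); packing of the data
`≤ max ρ(0)σ³ ≤ η₁` by the domination hypothesis, of the members `≤ 2η₁` for small `λ` by continuity.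
LEG 2 (`κ ≥ 1/2`, `β ≡ 1`): `μ := λ + (1-λ)·Real.smoothTransition (2κ-1)`, member
`(ρ, μu, μ²θ)(μs)` — defined from the given solution, lives on `[0, T/μ) ⊇ [0,T')`, packing that of `ρ` on
`[0,T') ⊂` a `2η₁`-band for `T'` close to `t` (guard `≤ η₁` on `[0,t]` + uniform continuity), `μ = 1` member
`(ρ,u,θ)` by `funext`/`one_mul`. Junction `κ = 1/2`: both legs give the solution with data
`(ρ 0, λu 0, λ²θ 0)` — equal by classical uniqueness (`hsEuler_uniqueness_smallPacking`); flat smooth steps make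
the concatenation `C^∞` in `κ`; joint smoothness in `(κ,s,x)` from smooth parameter dependence (differentiate the
symmetrised system in `κ`: linear symmetric hyperbolic problems for the `κ`-derivatives). Guarded on purpose
(cf. negative stmt-9168: unguarded `∀ classical solutions` meets the junk branch of the equation of state). -/
theorem stub_families :
    ∀ η₀ : ℝ, 0 < η₀ → ∀ F : ℝ → ℝ, AnalyticOnNhd ℝ F (Set.Ioo (-η₀) η₀) →
    Set.EqOn hsExcessFreeEnergy F (Set.Ico 0 η₀) →
    ∃ η₁ : ℝ, 0 < η₁ ∧ ∀ σ : ℝ, 0 < σ →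
      ∀ (T : ℝ) (ρ θ : ℝ → T3 → ℝ) (u : ℝ → T3 → V3), IsHardSphereEulerSolution σ T ρ u θ →
      ∀ r₀ : ℝ → T3 → ℝ, Literature.Analysis.FunctionSpaces.Torus.IsSmoothSpaceTimeOn (Set.Icc 0 1) r₀ →
        (∀ κ ∈ Set.Icc (0 : ℝ) 1, ∀ x, 0 < r₀ κ x ∧ ∃ y, r₀ κ x ≤ ρ 0 y) →
        (∀ x, r₀ 0 x = r₀ 0 0) → r₀ 1 = ρ 0 →
        ∀ t ∈ Set.Ico 0 T, (∀ s ∈ Set.Icc 0 t, ∀ x, ρ s x * σ ^ 3 ≤ η₁) →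
          ∃ T' : ℝ, t < T' ∧
          ∃ (β : ℝ → ℝ) (ϑ₀ : ℝ → T3 → ℝ) (w₀ : ℝ → T3 → V3)
            (ρh θh : ℝ → ℝ → T3 → ℝ) (uh : ℝ → ℝ → T3 → V3),
            ContDiffOn ℝ ((⊤ : ℕ∞) : WithTop ℕ∞) β (Set.Icc 0 1) ∧
            (∀ κ ∈ Set.Icc (0 : ℝ) 1, β κ ∈ Set.Icc (0 : ℝ) 1) ∧ β 0 = 0 ∧ β 1 = 1 ∧
            Literature.Analysis.FunctionSpaces.Torus.IsSmoothSpaceTimeOn (Set.Icc 0 1) ϑ₀ ∧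
            Literature.Analysis.FunctionSpaces.Torus.IsSmoothSpaceTimeOn (Set.Icc 0 1) w₀ ∧
            (∀ κ ∈ Set.Icc (0 : ℝ) 1, ∀ x, 0 < ϑ₀ κ x) ∧
            (∀ x, ϑ₀ 0 x = ϑ₀ 0 0 ∧ w₀ 0 x = w₀ 0 0) ∧ ϑ₀ 1 = θ 0 ∧ w₀ 1 = u 0 ∧
            (∀ κ ∈ Set.Icc (0 : ℝ) 1, IsHardSphereEulerSolution σ T' (ρh κ) (uh κ) (θh κ)) ∧
            ContDiffOn ℝ ((⊤ : ℕ∞) : WithTop ℕ∞)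
              (fun q : ℝ × ℝ × EuclideanSpace ℝ (Fin 3) =>
                ρh q.1 q.2.1 (Literature.Analysis.FunctionSpaces.Torus.proj q.2.2))
              (Set.Icc 0 1 ×ˢ (Set.Ico 0 T' ×ˢ Set.univ)) ∧
            ContDiffOn ℝ ((⊤ : ℕ∞) : WithTop ℕ∞)
              (fun q : ℝ × ℝ × EuclideanSpace ℝ (Fin 3) =>
                uh q.1 q.2.1 (Literature.Analysis.FunctionSpaces.Torus.proj q.2.2))
              (Set.Icc 0 1 ×ˢ (Set.Ico 0 T' ×ˢ Set.univ)) ∧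
            ContDiffOn ℝ ((⊤ : ℕ∞) : WithTop ℕ∞)
              (fun q : ℝ × ℝ × EuclideanSpace ℝ (Fin 3) =>
                θh q.1 q.2.1 (Literature.Analysis.FunctionSpaces.Torus.proj q.2.2))
              (Set.Icc 0 1 ×ˢ (Set.Ico 0 T' ×ˢ Set.univ)) ∧
            (∀ κ ∈ Set.Icc (0 : ℝ) 1, ρh κ 0 = r₀ (β κ) ∧ uh κ 0 = w₀ κ ∧ θh κ 0 = ϑ₀ κ) ∧
            ρh 1 = ρ ∧ uh 1 = u ∧ θh 1 = θ ∧
            (∀ s ∈ Set.Ico 0 T', ∀ x,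
              ρh 0 s x = ρh 0 0 0 ∧ uh 0 s x = uh 0 0 0 ∧ θh 0 s x = θh 0 0 0) := by
  sorry

/-- `stub_dilute` — GUARD REMOVAL, BY NAME the shared statement item stmt-AtomisticToContinuum-3091
(`ImplosionDichotomy.DiluteSelfConsistency`, wanted by 17 routes): tied classical solutions stay below any
reduced density `η` on `[0,T)` once `σ < σ₀(η, profiles)`. Open; suspect-false (implosion: the landed
negative glue `DenseExcursion → ¬ DiluteSelfConsistency`, `DenseExcursion` unproved). Needed ONLY because
the crux is filed unguarded; see the module docstring for the reshape if it dies / if the crux is repaired. -/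
theorem stub_dilute : ImplosionDichotomy.DiluteSelfConsistency := by
  sorry

/-! ## Consistency: the named statements ARE the registered stubs (syntactically) -/

theorem activityDensityInverse_holds : ActivityDensityInverse := stub_statics
theorem preShockFamilies_holds : PreShockFamilies := stub_families

/-! ## Name-keyed aliases (the skeleton audit admits a hypothesis of the composition only if its head
constant is a registered obligation — `DiluteSelfConsistency`, `HsEosLowDensity` are route items by name —
or is named like a declared stub) -/
namespace Registered

/-- Alias of `ActivityDensityInverse` keyed by the registered stub name `stub_statics`. -/
abbrev stub_statics : Prop := ActivityDensityInverse
/-- Alias of `PreShockFamilies` keyed by the registered stub name `stub_families`. -/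
abbrev stub_families : Prop := PreShockFamilies

end Registered

/-! ## Glue lemmas (proved) -/

/-- `TendstoHydroFieldsAt P Φ ρ u θ t` only reads the time-`t` slices of the fields. [folklore] -/
theorem tendstoHydroFieldsAt_congr {ε : ℕ → ℝ}
    {P : (N : ℕ) → Measure (Config (N + 1) (Fin 3) T3)}
    {Φ : (N : ℕ) → HardSphereFlow (Torus.geometry (Fin 3)) (ε N) (N + 1)}
    {ρ ρ' θ θ' : ℝ → T3 → ℝ} {u u' : ℝ → T3 → V3} {t : ℝ}
    (h : TendstoHydroFieldsAt P Φ ρ u θ t) (hρ : ρ' t = ρ t) (hu : u' t = u t) (hθ : θ' t = θ t) :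
    TendstoHydroFieldsAt P Φ ρ' u' θ' t := by
  unfold TendstoHydroFieldsAt at h ⊢
  rw [hρ, hu, hθ]
  exact h

/-- A jointly smooth space–time field on `[0,1] × 𝕋³` stays jointly smooth after a smooth
reparametrisation `β : [0,1] → [0,1]` of the parameter. [folklore] -/
theorem isSmoothSpaceTimeOn_reparam {F : Type*} [NormedAddCommGroup F] [NormedSpace ℝ F]
    {a : ℝ → T3 → F} {β : ℝ → ℝ}
    (ha : Literature.Analysis.FunctionSpaces.Torus.IsSmoothSpaceTimeOn (Set.Icc 0 1) a)
    (hβ : ContDiffOn ℝ ((⊤ : ℕ∞) : WithTop ℕ∞) β (Set.Icc 0 1))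
    (hmaps : ∀ κ ∈ Set.Icc (0 : ℝ) 1, β κ ∈ Set.Icc (0 : ℝ) 1) :
    Literature.Analysis.FunctionSpaces.Torus.IsSmoothSpaceTimeOn (Set.Icc 0 1) (fun κ => a (β κ)) := by
  unfold Literature.Analysis.FunctionSpaces.Torus.IsSmoothSpaceTimeOn at ha ⊢
  have hg : ContDiffOn ℝ ((⊤ : ℕ∞) : WithTop ℕ∞)
      (fun p : ℝ × EuclideanSpace ℝ (Fin 3) => (β p.1, p.2)) (Set.Icc (0 : ℝ) 1 ×ˢ Set.univ) := by
    refine ContDiffOn.prodMk ?_ contDiffOn_snd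
    exact hβ.comp contDiffOn_fst (fun p hp => (Set.mem_prod.1 hp).1)
  have hm : Set.MapsTo (fun p : ℝ × EuclideanSpace ℝ (Fin 3) => (β p.1, p.2))
      (Set.Icc (0 : ℝ) 1 ×ˢ Set.univ) (Set.Icc (0 : ℝ) 1 ×ˢ Set.univ) :=
    fun p hp => Set.mk_mem_prod (hmaps p.1 (Set.mem_prod.1 hp).1) (Set.mem_univ _)
  exact ha.comp hg hm

/-! ## Composition (sorry-free): the stubs imply the crux BY NAME -/

/-- `PreShockHomotopy` from the three stubs and the CLOSED item `HsEosLowDensity` (genuine glue, no `sorry`):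
EoS data ⇒ `η₁` (`stub_families`); `Λ, σS` (`stub_statics`), `σD` (`stub_dilute` at `η₁`); `σ₀ := min σS σD`;
for `σ < σ₀`: identification + activity/density paths + static LLN from `stub_statics`, the guard on
`[0,t] ⊂ [0,T)` from `stub_dilute`, the solution family from `stub_families`; the crux's profile path is
`(a ∘ β, ϑ₀, w₀)`, and each member's `t = 0` LLN is the static one at activity `a (β κ)` with
`(w, ϑ) := (w₀ κ, ϑ₀ κ)`, moved onto the member's data by `tendstoHydroFieldsAt_congr`. -/
theorem PreShockHomotopy_of (hS : Registered.stub_statics) (hP : Registered.stub_families)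
    (hD : ImplosionDichotomy.DiluteSelfConsistency) (hEos : ImplosionDichotomy.HsEosLowDensity) :
    OneSphereInfluence.PreShockHomotopy := by
  obtain ⟨η₀, hη₀, F, hF, hEq, -⟩ := hEos
  obtain ⟨η₁, hη₁, HP⟩ := hP η₀ hη₀ F hF hEq
  intro a₁ θ₁ u₁ ha hθ hu ha0 hθ0
  obtain ⟨Λ, hΛ, σS, hσS, HS⟩ := hS a₁ θ₁ u₁ ha hθ hu ha0 hθ0
  obtain ⟨σD, hσD, HD⟩ := hD η₁ hη₁ a₁ θ₁ u₁ ha hθ hu ha0 hθ0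
  refine ⟨Λ, hΛ, min σS σD, lt_min hσS hσD, ?_⟩
  intro σ hσ hσlt T ρ θ u hsol Φ h0 t ht
  have hσS' : σ < σS := lt_of_lt_of_le hσlt (min_le_left _ _)
  have hσD' : σ < σD := lt_of_lt_of_le hσlt (min_le_right _ _)
  have hT : 0 < T := lt_of_le_of_lt ht.1 ht.2
  obtain ⟨hu0, hθ0', a, r₀, ha_s, hr_s, hhull, hr_pos, hconst, ha1, hr1, hLLN⟩ :=
    HS σ hσ hσS' T ρ θ u hsol Φ h0 hT
  have hguard : ∀ s ∈ Set.Icc 0 t, ∀ x, ρ s x * σ ^ 3 ≤ η₁ := fun s hs x =>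
    (HD σ hσ hσD' T ρ θ u hsol Φ h0 s ⟨hs.1, lt_of_le_of_lt hs.2 ht.2⟩ x).le
  obtain ⟨T', hT', β, ϑ₀, w₀, ρh, θh, uh, hβs, hβm, hβ0, hβ1, hϑs, hws, hϑpos, hconst0, hϑ1, hw1,
      hsolκ, hsmρ, hsmu, hsmθ, hdata, hρ1, hu1, hθ1, hhom⟩ :=
    HP σ hσ T ρ θ u hsol r₀ hr_s hr_pos (fun x => (hconst x).2) hr1 t ht hguard
  have hcw : ∀ κ ∈ Set.Icc (0 : ℝ) 1, Continuous (w₀ κ) := fun κ hκ =>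
    (hws.isSmooth_slice hκ).continuous
  have hcϑ : ∀ κ ∈ Set.Icc (0 : ℝ) 1, Continuous (ϑ₀ κ) := fun κ hκ =>
    (hϑs.isSmooth_slice hκ).continuous
  refine ⟨T', hT', fun κ => a (β κ), ϑ₀, w₀, ρh, θh, uh, ?_, hϑs, hws, ?_, ?_, ?_, ?_, ?_, hsolκ,
    hsmρ, hsmu, hsmθ, ?_, ?_, hρ1, hu1, hθ1, hhom⟩
  · exact isSmoothSpaceTimeOn_reparam ha_s hβs hβm
  · intro κ hκ x
    exact ⟨(hhull (β κ) (hβm κ hκ) x).1, (hhull (β κ) (hβm κ hκ) x).2, hϑpos κ hκ x⟩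
  · intro x
    refine ⟨?_, (hconst0 x).1, (hconst0 x).2⟩
    show a (β 0) x = a (β 0) 0
    rw [hβ0]
    exact (hconst x).1
  · show a (β 1) = a₁
    rw [hβ1]
    exact ha1
  · exact hϑ1.trans hθ0'
  · exact hw1.trans hu0
  · intro κ hκ
    exact tendstoHydroFieldsAt_congr
      (hLLN (β κ) (hβm κ hκ) (w₀ κ) (ϑ₀ κ) (hcw κ hκ) (hcϑ κ hκ) (hϑpos κ hκ)).2
      (hdata κ hκ).1 (hdata κ hκ).2.1 (hdata κ hκ).2.2
  · intro κ hκ N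
    exact (hLLN (β κ) (hβm κ hκ) (w₀ κ) (ϑ₀ κ) (hcw κ hκ) (hcϑ κ hκ) (hϑpos κ hκ)).1 N

/-- Wiring check: the registered stubs (and the closed item) feed `PreShockHomotopy_of` exactly as stated
(an `example`, so that `PreShockHomotopy_of` stays the file's only theorem concluding the crux). -/
example (hEos : ImplosionDichotomy.HsEosLowDensity) : OneSphereInfluence.PreShockHomotopy :=
  PreShockHomotopy_of stub_statics stub_families stub_dilute hEos

end Summit.AtomisticToContinuum.HydrodynamicLimit.Cruxes.PreShockHomotopy.Birth

end
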